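import Summits.QuantumFields.YangMills.Theorems.FluctuationComparisonRegPrIntLS2BetaFibreTransport
import HarnessLib

/-!
# (RG-K ⊕ WREG) FIBRE TRANSPORT, §4: the (L3) transversal-Hessian GROWTH row reduces to OFF-PIVOT TRANSVERSALITY of the tube

Definition-free helper for LINE g18-1 `Cruxes/FluctuationComparisonRegPrIntL/Lines/semiclassical_s2beta.lean` (crux `stmt-QuantumFields-20520`, row
LAPLACE; w4-20520 g15's v8 stub `stub_transversalHessian` in the (L3) form «`ContDiffAt ℝ 2 (A ∘ Φ_V ∘ σ) 0` + growth `c₁‖y‖² ≤ A (Φ_V (σ y)) − m`»).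
The GROWTH half needs no smoothness: GAP♯ bounds the excess action of the chart value by its residual-orbit distance (✓`…S2BetaFibreTransport` §3), the
chart value has `z`'s OFF-PIVOT coordinates, and the off-pivot part of the orbit distance is dominated by the whole — so any lower bound `t` (of record:
`t := c₁‖y‖²` at `z := σ y`) for the OFF-PIVOT residual-orbit distance of `z` gives `m + μ′ t ≤ A (Φ (V, z))`.  What remains for the growth row is therefore a
CHART-SIDE metric transversality of the tube `σ` to the residual orbit in off-pivot coordinates (px21 g9's (C3) chart), and for the `ContDiffAt` half the
`C²`-regularity of `Φ (V, ·)` along `σ` (not addressed here).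

* ★ `growth_of_offPivot_orbitDist_le` — the reduction, pointwise in `z`, abstract in the chart `Φ` (rows `hoff`, `hfib` as in §3).

HONEST: bookkeeping; proves NO stub — EXW, GAP♯, LAPLACE, H4ᶜ, LFR♯ᶜ, S2β and crux 20520 stay OPEN; rung R3 (YM₃ on T³) is NOT d = 4, NOT infinite volume,
NOT a mass gap, NOT Clay; the Yang–Mills mass gap is NOT proved.
-/

noncomputable section

open MeasureTheory Filter Topology Set Function
open Literature.MathematicalPhysics.QuantumFieldTheory.Balaban1983to89
open Literature.MathematicalPhysics.QuantumFieldTheory.Balaban1983to89.T3ContinuumYM3Torus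
open Literature.MathematicalPhysics.QuantumFieldTheory.Balaban1983to89.T3UnitLawDensityEML
open Literature.MathematicalPhysics.QuantumFieldTheory.Balaban1983to89.T3UnitScaleTilt
open Literature.MathematicalPhysics.QuantumFieldTheory.Balaban1983to89.T3TiltDescent
open Literature.MathematicalPhysics.QuantumFieldTheory.Balaban1983to89.T3ConstrainedMinimiser (fibre)
open Literature.MathematicalPhysics.QuantumFieldTheory.Balaban1983to89.T4Continuum
open scoped Literature.MathematicalPhysics.QuantumFieldTheory.Balaban1983to89.T3OrbitAverage
open Summit.QuantumFields.YangMills.Theorems.FluctuationComparisonRegPrIntLWregChain (iterCentralBond)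
open Summit.QuantumFields.YangMills.Theorems.FluctuationComparisonRegPrIntLS2BetaResidualGauge

namespace Summit.QuantumFields.YangMills.Theorems.FluctuationComparisonRegPrIntLS2BetaFibreGrowth

section Growth

variable (F : T3Family) {J K : ℕ} (hJK : J ≤ K)

/-- ★ **THE (L3) GROWTH ROW FROM GAP♯ AND OFF-PIVOT TRANSVERSALITY** (pointwise; the input of ✓`…S2BetaLaplacePeano.hessianRows_of_contDiffAt_of_growth` ∕
✓`…S2BetaLaplaceLimit.inner_ge_of_quadratic_growth` along a transversal `σ`, read at `z := σ y`, `t := c₁‖y‖²`): at a point `z` of the carrier whose chart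
value lies in `Sf`, ANY lower bound `t` for the residual-orbit distance of `z` computed on the OFF-PIVOT bonds only is a lower bound for `(wilsonAction4 (Φ (V,z)) − m)∕μ′`
— because the chart value has `z`'s off-pivot coordinates (`hoff`), the off-pivot sum is dominated by the full sum, and GAP♯ bounds the full orbit distance of the
chart value (which lies in the fibre, `hfib`) by the excess action.  So the transversal-Hessian growth row of the LAPLACE docking reduces to a CHART-SIDE metric
transversality of the tube `σ` to the residual orbit in off-pivot coordinates (no smoothness of `Φ` involved).
[cite: Balaban1985Variational, Thm 1 (8)-(10) p.279 and (142) p.299; Balaban1987RG1, (0.4) p.253] -/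
theorem growth_of_offPivot_orbitDist_le
    (Φ : GaugeField (F.P J) 0 (Matrix.specialUnitaryGroup (Fin 2) ℂ) × GaugeField (F.P K) 0 (Matrix.specialUnitaryGroup (Fin 2) ℂ) →
      GaugeField (F.P K) 0 (Matrix.specialUnitaryGroup (Fin 2) ℂ))
    {Sf : Set (GaugeField (F.P K) 0 (Matrix.specialUnitaryGroup (Fin 2) ℂ))}
    {V : GaugeField (F.P J) 0 (Matrix.specialUnitaryGroup (Fin 2) ℂ)} {m μ' : ℝ} (hμ' : 0 < μ')
    {U₀ : GaugeField (F.P K) 0 (Matrix.specialUnitaryGroup (Fin 2) ℂ)}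
    (hgap : ∀ U ∈ fibre F ℰp J K hJK V, U ∈ Sf →
      μ' * (⨅ w : {w : Site (F.P K) 0 → Matrix.specialUnitaryGroup (Fin 2) ℂ |
              ∀ U : GaugeField (F.P K) 0 (Matrix.specialUnitaryGroup (Fin 2) ℂ),
                descendTo F ℰp J K hJK (GaugeField.gaugeAct w U) = descendTo F ℰp J K hJK U},
            ∑ ℓ : PBond (F.P K) 0,
              dist1 (U ℓ * ((GaugeField.gaugeAct (w : Site (F.P K) 0 → Matrix.specialUnitaryGroup (Fin 2) ℂ) U₀) ℓ)⁻¹) ^ 2)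
        ≤ wilsonAction4 U - m)
    {Xc : Set (GaugeField (F.P K) 0 (Matrix.specialUnitaryGroup (Fin 2) ℂ))}
    (hoff : ∀ z ∈ Xc, ∀ b, (∀ c, iterCentralBond (P := F.P K) (K - J) c ≠ b) → Φ (V, z) b = z b)
    (hfib : ∀ z ∈ Xc, descendTo F ℰp J K hJK (Φ (V, z)) = V)
    {z : GaugeField (F.P K) 0 (Matrix.specialUnitaryGroup (Fin 2) ℂ)} (hz : z ∈ Xc) (hzS : Φ (V, z) ∈ Sf) {t : ℝ}
    (ht : t ≤ ⨅ w : {w : Site (F.P K) 0 → Matrix.specialUnitaryGroup (Fin 2) ℂ |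
              ∀ U : GaugeField (F.P K) 0 (Matrix.specialUnitaryGroup (Fin 2) ℂ),
                descendTo F ℰp J K hJK (GaugeField.gaugeAct w U) = descendTo F ℰp J K hJK U},
            ∑ ℓ ∈ Finset.univ.filter (fun ℓ : PBond (F.P K) 0 => ∀ c, iterCentralBond (P := F.P K) (K - J) c ≠ ℓ),
              dist1 (z ℓ * ((GaugeField.gaugeAct (w : Site (F.P K) 0 → Matrix.specialUnitaryGroup (Fin 2) ℂ) U₀) ℓ)⁻¹) ^ 2) :
    m + μ' * t ≤ wilsonAction4 (Φ (V, z)) := by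
  classical
  haveI := compactSpace_residualGauge F hJK
  haveI : Nonempty {w : Site (F.P K) 0 → Matrix.specialUnitaryGroup (Fin 2) ℂ |
              ∀ U : GaugeField (F.P K) 0 (Matrix.specialUnitaryGroup (Fin 2) ℂ),
                descendTo F ℰp J K hJK (GaugeField.gaugeAct w U) = descendTo F ℰp J K hJK U} := ⟨⟨1, residual_one F hJK⟩⟩
  -- the off-pivot orbit distance of `z` is the off-pivot orbit distance of `Φ (V, z)`, dominated by the full one
  have hle : ∀ w : {w : Site (F.P K) 0 → Matrix.specialUnitaryGroup (Fin 2) ℂ |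
              ∀ U : GaugeField (F.P K) 0 (Matrix.specialUnitaryGroup (Fin 2) ℂ),
                descendTo F ℰp J K hJK (GaugeField.gaugeAct w U) = descendTo F ℰp J K hJK U},
      (∑ ℓ ∈ Finset.univ.filter (fun ℓ : PBond (F.P K) 0 => ∀ c, iterCentralBond (P := F.P K) (K - J) c ≠ ℓ),
          dist1 (z ℓ * ((GaugeField.gaugeAct (w : Site (F.P K) 0 → Matrix.specialUnitaryGroup (Fin 2) ℂ) U₀) ℓ)⁻¹) ^ 2) ≤
        ∑ ℓ : PBond (F.P K) 0,
          dist1 (Φ (V, z) ℓ * ((GaugeField.gaugeAct (w : Site (F.P K) 0 → Matrix.specialUnitaryGroup (Fin 2) ℂ) U₀) ℓ)⁻¹) ^ 2 := by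
    intro w
    have heq : (∑ ℓ ∈ Finset.univ.filter (fun ℓ : PBond (F.P K) 0 => ∀ c, iterCentralBond (P := F.P K) (K - J) c ≠ ℓ),
        dist1 (z ℓ * ((GaugeField.gaugeAct (w : Site (F.P K) 0 → Matrix.specialUnitaryGroup (Fin 2) ℂ) U₀) ℓ)⁻¹) ^ 2) =
        ∑ ℓ ∈ Finset.univ.filter (fun ℓ : PBond (F.P K) 0 => ∀ c, iterCentralBond (P := F.P K) (K - J) c ≠ ℓ),
          dist1 (Φ (V, z) ℓ * ((GaugeField.gaugeAct (w : Site (F.P K) 0 → Matrix.specialUnitaryGroup (Fin 2) ℂ) U₀) ℓ)⁻¹) ^ 2 :=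
      Finset.sum_congr rfl fun ℓ hℓ => by rw [hoff z hz ℓ (Finset.mem_filter.1 hℓ).2]
    rw [heq]
    exact Finset.sum_le_sum_of_subset_of_nonneg (Finset.filter_subset _ _) fun ℓ _ _ => sq_nonneg _
  have hbdd : BddBelow (Set.range fun w : {w : Site (F.P K) 0 → Matrix.specialUnitaryGroup (Fin 2) ℂ |
              ∀ U : GaugeField (F.P K) 0 (Matrix.specialUnitaryGroup (Fin 2) ℂ),
                descendTo F ℰp J K hJK (GaugeField.gaugeAct w U) = descendTo F ℰp J K hJK U} =>
      ∑ ℓ ∈ Finset.univ.filter (fun ℓ : PBond (F.P K) 0 => ∀ c, iterCentralBond (P := F.P K) (K - J) c ≠ ℓ),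
        dist1 (z ℓ * ((GaugeField.gaugeAct (w : Site (F.P K) 0 → Matrix.specialUnitaryGroup (Fin 2) ℂ) U₀) ℓ)⁻¹) ^ 2) :=
    ⟨0, by rintro _ ⟨w, rfl⟩; exact Finset.sum_nonneg fun ℓ _ => sq_nonneg _⟩
  have hinf : (⨅ w : {w : Site (F.P K) 0 → Matrix.specialUnitaryGroup (Fin 2) ℂ |
              ∀ U : GaugeField (F.P K) 0 (Matrix.specialUnitaryGroup (Fin 2) ℂ),
                descendTo F ℰp J K hJK (GaugeField.gaugeAct w U) = descendTo F ℰp J K hJK U},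
      ∑ ℓ ∈ Finset.univ.filter (fun ℓ : PBond (F.P K) 0 => ∀ c, iterCentralBond (P := F.P K) (K - J) c ≠ ℓ),
        dist1 (z ℓ * ((GaugeField.gaugeAct (w : Site (F.P K) 0 → Matrix.specialUnitaryGroup (Fin 2) ℂ) U₀) ℓ)⁻¹) ^ 2) ≤
      ⨅ w : {w : Site (F.P K) 0 → Matrix.specialUnitaryGroup (Fin 2) ℂ |
              ∀ U : GaugeField (F.P K) 0 (Matrix.specialUnitaryGroup (Fin 2) ℂ),
                descendTo F ℰp J K hJK (GaugeField.gaugeAct w U) = descendTo F ℰp J K hJK U},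
        ∑ ℓ : PBond (F.P K) 0,
          dist1 (Φ (V, z) ℓ * ((GaugeField.gaugeAct (w : Site (F.P K) 0 → Matrix.specialUnitaryGroup (Fin 2) ℂ) U₀) ℓ)⁻¹) ^ 2 :=
    le_ciInf fun w => (ciInf_le hbdd w).trans (hle w)
  have h := hgap (Φ (V, z)) (hfib z hz) hzS
  nlinarith [mul_le_mul_of_nonneg_left (ht.trans hinf) hμ'.le]

end Growth

end Summit.QuantumFields.YangMills.Theorems.FluctuationComparisonRegPrIntLS2BetaFibreGrowth

end
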